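import Mathlib
import HarnessLib
import Summits.HubbardSuperconductivity.HubbardSuperconductivity.Theorems.KLProgrammeKLRegimeSplitTwoLegSizesMSChainGraded
import Summits.HubbardSuperconductivity.HubbardSuperconductivity.Theorems.KLProgrammeKLRegimeSplitTwoLegSizesMSWithChain
import Summits.HubbardSuperconductivity.HubbardSuperconductivity.Theorems.KLProgrammeKLRegimeSplitTwoLegSizesMSProfileOsc

/-!
# Route `KLProgramme`, crux K3 — (E3a-MS) supplier, the DEPTH-GRADED term table (repair MS-A34 (R-b); k3c3-p1 g4)

Seat hubbard-kl-k3c3-p1 (g4).  `…MSChainTableF` (g3) tabulates the centred angular sizes and the means of the chain-family profiles with ONE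
pair of order-3/4 curve budgets `A₃, A₄` for every chain frame; `…MSChainGraded` (this generation) graded the budgets by depth.  This file is
the graded table: the tower constants are functions `A₃ A₄ : ℕ → ℝ` of the CHAIN POSITION `k` (`A₃ k ≥ chainSizeSumG … k 3`, `A₄ k ≥ chainSizeSumG … k 4`,
`k ≤ N − n`), the base profile reads `A₃ 0, A₄ 0`, the slot-`m` profile (`k = m − n`: frames `k − 1`, `k`) reads `A₃ (m − n), A₄ (m − n)`:

* `msGsFG` / `msMeanFG` — the graded size and mean tables;
* `msProfileF_centred_sizes_graded`, `abs_klAngularMean_msProfileF_le_graded` — the proofs of `…MSChainTableF` re-run on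
  `chain_curve_sizes_graded` / `chain_step_curve_diff_graded`;
* `twoLegSizesMSWith_succ_of_chainF_table_graded` / `twoLegSizesMSWith_zero_of_chainF_table_graded` — the budget-parametric slot text at
  scale `n+1` / `0` with the COMPUTED sizes `msSizeBaseO X σ (A₃ 0) (A₄ 0)` (base) and `msSizeSlotO X σ ε A (A₃ (m−n₀)) (A₄ (m−n₀)) Dt e n₀ m` (slots)
  — the `…O` shapes carry the OSCILLATION entry `bellCumOsc` of `…MSProfileOsc` at order `0` (repair «MS-A0»: the tadpole-sized sup no longer enters) —
  no fit hypothesis (the caller's `.mono fit_n fit_m` keys them to `twoLegBar` / `msBarQ · pieceSize`).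

Proofs only; nothing about the model.
-/

noncomputable section

namespace Summit.HubbardSuperconductivity.HubbardSuperconductivity.Theorems.KLRegimeSplit

set_option linter.dupNamespace false -- summit = problem name (single-conjunct summit), D-0017
set_option maxSynthPendingDepth 4 -- nested operator-norm instances (symbol sizes up to order five), as in `…CompDiff`

open Real Finset Literature.MathematicalPhysics.QuantumLattice Literature.MathematicalPhysics.QuantumLattice.FermiRG
open Literature.MathematicalPhysics.QuantumLattice.BandSectorCounting
open Summit.HubbardSuperconductivity.HubbardSuperconductivity.Theorems.KLProgrammeLegKernels
open Summit.HubbardSuperconductivity.HubbardSuperconductivity.Theorems.DispersionFlow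
open Summit.HubbardSuperconductivity.HubbardSuperconductivity.Theorems.PerturbedFermiCurve

/-! ## §1 The graded tables -/

/-- **THE GRADED TERM TABLE** (oscillation entries at order `0`, `…MSProfileOsc`): base `m = n ↦ bellCumOsc (σ 0) (msD (A₃ 0) (A₄ 0))`, slot
`m ∈ Ioc n N ↦` response `bellCumOsc (ε m) (msD (A₃ k) (A₄ k))` +
transport `bellDiffCum (σ (k−1)) (msD (A₃ k) (A₄ k)) (msdD A (A₃ k) (A₄ k) Dt (e m))`, `k = m − n`; else `0`. -/
def msGsFG (σ ε : ℕ → ℕ → ℝ) (A : ℝ) (A₃ A₄ : ℕ → ℝ) (Dt : ℝ) (e : ℕ → ℕ → ℝ) (n N m j : ℕ) : ℝ :=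
  if m = n then bellCumOsc (σ 0) (msD (A₃ 0) (A₄ 0)) j
  else if m ∈ Ioc n N then
    bellCumOsc (ε m) (msD (A₃ (m - n)) (A₄ (m - n))) j +
      bellDiffCum (σ (m - n - 1)) (msD (A₃ (m - n)) (A₄ (m - n))) (msdD A (A₃ (m - n)) (A₄ (m - n)) Dt (e m)) j
  else 0

/-- **THE GRADED MEAN TABLE**: `σ 0 0` for the base profile, `ε m 0 + σ (k−1) 1 · msdD A (A₃ k) (A₄ k) Dt (e m) 0` for a slot, else `0`. -/
def msMeanFG (σ ε : ℕ → ℕ → ℝ) (A : ℝ) (A₃ A₄ : ℕ → ℝ) (Dt : ℝ) (e : ℕ → ℕ → ℝ) (n N m : ℕ) : ℝ :=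
  if m = n then σ 0 0 else if m ∈ Ioc n N then ε m 0 + σ (m - n - 1) 1 * msdD A (A₃ (m - n)) (A₄ (m - n)) Dt (e m) 0 else 0

/-- **The BASE size shape with the oscillation entry**: `extSize X (σ 0 0) (bellCumOsc (σ 0) (msD A₃ A₄) j) j`. -/
def msSizeBaseO (X : ℝ) (σ : ℕ → ℕ → ℝ) (A₃ A₄ : ℝ) (j : ℕ) : ℝ :=
  extSize X (σ 0 0) (bellCumOsc (σ 0) (msD A₃ A₄) j) j

/-- **The SLOT size shape with the oscillation entry** (slot `m`, `k = m − n₀`): response `bellCumOsc (ε m) …` + transport `bellDiffCum (σ (k−1)) …`. -/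
def msSizeSlotO (X : ℝ) (σ ε : ℕ → ℕ → ℝ) (A A₃ A₄ Dt : ℝ) (e : ℕ → ℕ → ℝ) (n₀ m j : ℕ) : ℝ :=
  extSize X (ε m 0 + σ (m - n₀ - 1) 1 * msdD A A₃ A₄ Dt (e m) 0)
    (bellCumOsc (ε m) (msD A₃ A₄) j + bellDiffCum (σ (m - n₀ - 1)) (msD A₃ A₄) (msdD A A₃ A₄ Dt (e m)) j) j

/-- `msSizeBaseO` unfolded. -/
theorem msSizeBaseO_eq (X : ℝ) (σ : ℕ → ℕ → ℝ) (A₃ A₄ : ℝ) (j : ℕ) : msSizeBaseO X σ A₃ A₄ j =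
    (if j = 0 then σ 0 0 else 0) +
      (j.factorial : ℝ) ^ 2 * (2 * j.factorial * X * 200 ^ j) * bellCumOsc (σ 0) (msD A₃ A₄) j *
        (4 + max 1 (((j - 1).factorial : ℝ) / (8 / 5))) ^ j := rfl

/-- `msSizeSlotO` unfolded. -/
theorem msSizeSlotO_eq (X : ℝ) (σ ε : ℕ → ℕ → ℝ) (A A₃ A₄ Dt : ℝ) (e : ℕ → ℕ → ℝ) (n₀ m j : ℕ) :
    msSizeSlotO X σ ε A A₃ A₄ Dt e n₀ m j =
    (if j = 0 then ε m 0 + σ (m - n₀ - 1) 1 * msdD A A₃ A₄ Dt (e m) 0 else 0) +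
      (j.factorial : ℝ) ^ 2 * (2 * j.factorial * X * 200 ^ j) *
        (bellCumOsc (ε m) (msD A₃ A₄) j + bellDiffCum (σ (m - n₀ - 1)) (msD A₃ A₄) (msdD A A₃ A₄ Dt (e m)) j) *
        (4 + max 1 (((j - 1).factorial : ℝ) / (8 / 5))) ^ j := rfl

/-! ## §2 The graded sizes and means of all chain-family profiles -/

section Table

variable (d : ℕ) {Kp : ℕ → TrigPolyC4v} {n N : ℕ} (hnN : n ≤ N) {a : ℕ → ℕ → ℝ}
  (ha : ∀ m ≤ N, ∀ j ≤ 4, ∀ q : Momentum, ‖iteratedFDeriv ℝ j (evalM (Kp m)) q‖ ≤ a m j)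

include hnN ha in
/-- **CENTRED ANGULAR SIZES OF ALL CHAIN-FAMILY PROFILES, depth-graded.**  As `msProfileF_centred_sizes` (`…MSChainTableF`) with the uniform
`C²` budget `A ≥ chainSizeSumG … (N−n) j` (`j ≤ 2`) and DEPTH-GRADED order-3/4 budgets `A₃ k ≥ chainSizeSumG … k 3`, `A₄ k ≥ chainSizeSumG … k 4`. -/
theorem msProfileF_centred_sizes_graded (hann : ∀ m j, 0 ≤ a m j)
    {A : ℝ} (hA : ∀ j ≤ 2, chainSizeSumG d Kp a n N (N - n) j ≤ A) (hA20 : A ≤ 1 / 20)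
    (hd : klCurveD ≤ (bandBounds (show (-4 : ℝ) < -1.1 by norm_num) (show (-1.1 : ℝ) ≤ -0.1 by norm_num)
      (show (-0.1 : ℝ) < 0 by norm_num)).Dtmin - 2 * A)
    {μ : ℝ} (hlo : (-1.1 : ℝ) ≤ μ - A) (hhi : μ + A ≤ -0.1)
    {A₃ A₄ : ℕ → ℝ} (hA₃ : ∀ k ≤ N - n, chainSizeSumG d Kp a n N k 3 ≤ A₃ k) (hA₄ : ∀ k ≤ N - n, chainSizeSumG d Kp a n N k 4 ≤ A₄ k)
    (S : ℕ → TrigPolyC4v) {σ : ℕ → ℕ → ℝ} (hσnn : ∀ k l, 0 ≤ σ k l) (hσ0 : ∀ k ≤ N - n, ∀ q : Momentum, |evalM (S k) q| ≤ σ k 0)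
    (hσ : ∀ k ≤ N - n, ∀ l, 1 ≤ l → l ≤ 5 → ∀ q : Momentum, ‖iteratedFDeriv ℝ l (evalM (S k)) q‖ ≤ σ k l)
    {ε : ℕ → ℕ → ℝ} (hεnn : ∀ m l, 0 ≤ ε m l)
    (hε0 : ∀ m ∈ Ioc n N, ∀ q : Momentum, |evalM (fsub (S (m - n)) (S (m - n - 1))) q| ≤ ε m 0)
    (hε : ∀ m ∈ Ioc n N, ∀ l, 1 ≤ l → l ≤ 4 → ∀ q : Momentum,
      ‖iteratedFDeriv ℝ l (evalM (fsub (S (m - n)) (S (m - n - 1)))) q‖ ≤ ε m l)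
    {e : ℕ → ℕ → ℝ} (he : ∀ m ∈ Ioc n N, ∀ j ≤ 4, ∀ q : Momentum, ‖iteratedFDeriv ℝ j (evalM (highPart d (Kp m))) q‖ ≤ e m j)
    (m : ℕ) {j : ℕ} (hj : j ≤ 4) {i : ℕ} (hi : i ≤ j) (t : ℝ) :
    ‖iteratedFDeriv ℝ i (fun t => msProfileF μ S d Kp n N m t - klAngularMean (msProfileF μ S d Kp n N m)) t‖ ≤
      msGsFG σ ε A A₃ A₄ ((bandBounds (show (-4 : ℝ) < -1.1 by norm_num) (show (-1.1 : ℝ) ≤ -0.1 by norm_num)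
        (show (-0.1 : ℝ) < 0 by norm_num)).Dtmin) e n N m j := by
  set B := bandBounds (show (-4 : ℝ) < -1.1 by norm_num) (show (-1.1 : ℝ) ≤ -0.1 by norm_num) (show (-0.1 : ℝ) < 0 by norm_num)
    with hBdef
  -- the curve of frame `k' ≤ k` under the depth-`k` tower, in the `iteratedDeriv` key
  have hcurve : ∀ k ≤ N - n, ∀ k' ≤ k, ∀ θ,
      ContDiff ℝ 4 (fun θ : ℝ => (WithLp.toLp 2 (klFermiPoint μ (msChain d Kp n N k') θ) : Momentum)) ∧
      ContDiff ℝ 4 (klFermiPoint μ (msChain d Kp n N k')) ∧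
      ‖iteratedFDeriv ℝ 1 (fun θ : ℝ => (WithLp.toLp 2 (klFermiPoint μ (msChain d Kp n N k') θ) : Momentum)) θ‖ ≤ klCurveD1 ∧
      ‖iteratedFDeriv ℝ 2 (fun θ : ℝ => (WithLp.toLp 2 (klFermiPoint μ (msChain d Kp n N k') θ) : Momentum)) θ‖ ≤ klCurveD2 ∧
      ‖iteratedFDeriv ℝ 3 (fun θ : ℝ => (WithLp.toLp 2 (klFermiPoint μ (msChain d Kp n N k') θ) : Momentum)) θ‖ ≤ klCurveD3 (A₃ k) ∧
      ‖iteratedFDeriv ℝ 4 (fun θ : ℝ => (WithLp.toLp 2 (klFermiPoint μ (msChain d Kp n N k') θ) : Momentum)) θ‖ ≤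
        klCurveD4 (A₃ k) (A₄ k) :=
    fun k hk k' hk' θ => chain_curve_sizes_graded d hnN ha hann le_rfl hA hA20 hd hlo hhi (hk'.trans hk)
      ((chainSizeSumG_mono d hann hk' 3).trans (hA₃ k hk)) ((chainSizeSumG_mono d hann hk' 4).trans (hA₄ k hk)) θ
  have hDk : ∀ k ≤ N - n, ∀ k' ≤ k, ∀ i, 1 ≤ i → i ≤ 4 → ∀ θ,
      ‖iteratedDeriv i (fun θ : ℝ => (WithLp.toLp 2 (klFermiPoint μ (msChain d Kp n N k') θ) : Momentum)) θ‖ ≤ msD (A₃ k) (A₄ k) i := by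
    intro k hk k' hk' i hi1 hi4 θ
    obtain ⟨-, -, d1, d2, d3, d4⟩ := hcurve k hk k' hk' θ
    rw [← norm_iteratedFDeriv_eq_norm_iteratedDeriv]
    interval_cases i
    · exact d1
    · exact d2
    · exact d3
    · exact d4
  have hCk : ∀ k ≤ N - n, ContDiff ℝ 4 (fun θ : ℝ => (WithLp.toLp 2 (klFermiPoint μ (msChain d Kp n N k) θ) : Momentum)) :=
    fun k hk => (hcurve k hk k le_rfl 0).1
  have hCk' : ∀ k ≤ N - n, ContDiff ℝ 4 (klFermiPoint μ (msChain d Kp n N k)) :=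
    fun k hk => (hcurve k hk k le_rfl 0).2.1
  have hDnn : ∀ k ≤ N - n, ∀ i, 0 ≤ msD (A₃ k) (A₄ k) i := by
    intro k hk i
    rcases i with _ | _ | _ | _ | _ | i
    · simp [msD]
    · exact (norm_nonneg _).trans (hDk k hk k le_rfl 1 le_rfl (by norm_num) 0)
    · exact (norm_nonneg _).trans (hDk k hk k le_rfl 2 (by norm_num) (by norm_num) 0)
    · exact (norm_nonneg _).trans (hDk k hk k le_rfl 3 (by norm_num) (by norm_num) 0)
    · exact (norm_nonneg _).trans (hDk k hk k le_rfl 4 (by norm_num) (by norm_num) 0)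
    · simp [msD]
  by_cases hm : m = n
  · -- the base profile
    subst hm
    rw [msProfileF_base, msGsFG, if_pos rfl]
    exact curveProfile_centred_sizes_osc μ (S 0) (msChain d Kp m N 0) (hCk 0 (by omega)) (hσnn 0) (hDnn 0 (by omega)) (hσ0 0 (by omega))
      (fun k hk1 hk4 q => hσ 0 (by omega) k hk1 (by omega) q) (hDk 0 (by omega) 0 le_rfl) hj hi t
  by_cases hmem : m ∈ Ioc n N
  · -- a slot profile: response + transport
    set k := m - n with hkdef
    have hk1 : 1 ≤ k := by have := (Finset.mem_Ioc.mp hmem).1; omega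
    have hk : k ≤ N - n := by have := (Finset.mem_Ioc.mp hmem).2; omega
    have hmk : m = n + k := by have := (Finset.mem_Ioc.mp hmem).1; omega
    have hp : msProfileF μ S d Kp n N m = fun θ =>
        curveProfile μ (fsub (S k) (S (k - 1))) (msChain d Kp n N k) θ +
          (evalM (S (k - 1)) (WithLp.toLp 2 (klFermiPoint μ (msChain d Kp n N k) θ)) -
            evalM (S (k - 1)) (WithLp.toLp 2 (klFermiPoint μ (msChain d Kp n N (k - 1)) θ))) := by
      funext θ
      rw [msProfileF_slot μ S d Kp hmem θ, ← hkdef, curveProfile_apply μ (S (k - 1)), curveProfile_apply μ (S (k - 1))]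
    rw [hp, msGsFG, if_neg hm, if_pos hmem]
    have hfc : ContDiff ℝ 4 (curveProfile μ (fsub (S k) (S (k - 1))) (msChain d Kp n N k)) :=
      contDiff_curveProfile μ _ _ (hCk' k hk)
    have hgc : ContDiff ℝ 4 (fun θ => evalM (S (k - 1)) (WithLp.toLp 2 (klFermiPoint μ (msChain d Kp n N k) θ)) -
        evalM (S (k - 1)) (WithLp.toLp 2 (klFermiPoint μ (msChain d Kp n N (k - 1)) θ))) :=
      ((contDiff_evalM (S (k - 1))).comp (hCk k hk)).sub ((contDiff_evalM (S (k - 1))).comp (hCk (k - 1) (by omega)))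
    have hi4 : i ≤ 4 := hi.trans hj
    refine (norm_iteratedFDeriv_centred_add_le (hfc.of_le (by exact_mod_cast hi4)) (hgc.of_le (by exact_mod_cast hi4))
      (hfc.continuous.intervalIntegrable _ _) (hgc.continuous.intervalIntegrable _ _) t).trans (add_le_add ?_ ?_)
    · -- response term
      exact curveProfile_centred_sizes_osc μ (fsub (S k) (S (k - 1))) (msChain d Kp n N k) (hCk k hk) (hεnn m) (hDnn k hk) (hε0 m hmem)
        (fun l hl1 hl4 q => hε m hmem l hl1 hl4 q) (hDk k hk k le_rfl) hj hi t
    · -- transport term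
      have he' : ∀ j ≤ 4, ∀ q : Momentum, ‖iteratedFDeriv ℝ j (evalM (highPart d (Kp (n + k)))) q‖ ≤ e m j := by
        rw [← hmk]; exact he m hmem
      have hstep := chain_step_curve_diff_graded d hnN ha hann le_rfl hA hA20 hd hlo hhi hk1 hk (hA₃ k hk) (hA₄ k hk) he'
      have hdDnn : ∀ i, 0 ≤ msdD A (A₃ k) (A₄ k) B.Dtmin (e m) i := by
        intro i
        rcases i with _ | _ | _ | _ | _ | i
        · exact (norm_nonneg _).trans (hstep 0).1
        · exact (norm_nonneg _).trans ((hstep 0).2 1 le_rfl (by norm_num))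
        · exact (norm_nonneg _).trans ((hstep 0).2 2 (by norm_num) (by norm_num))
        · exact (norm_nonneg _).trans ((hstep 0).2 3 (by norm_num) (by norm_num))
        · exact (norm_nonneg _).trans ((hstep 0).2 4 (by norm_num) (by norm_num))
        · rw [msdD_add_five]; exact (norm_nonneg _).trans ((hstep 0).2 4 (by norm_num) (by norm_num))
      exact comp_sub_centred_sizes (F := evalM (S (k - 1))) (contDiff_evalM (S (k - 1))) (hCk (k - 1) (by omega)) (hCk k hk)
        (hσnn (k - 1)) (hDnn k hk) hdDnn (fun l hl1 hl5 q => hσ (k - 1) (by omega) l hl1 hl5 q)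
        (hDk k hk (k - 1) (Nat.sub_le k 1)) (hDk k hk k le_rfl) (fun θ => (hstep θ).1) (fun i hi1 hi4 θ => (hstep θ).2 i hi1 hi4)
        hj hi t
  · -- no profile
    rw [msProfileF_of_not_mem hm hmem, msGsFG, if_neg hm, if_neg hmem, klAngularMean_zero]
    simp

include hnN ha in
/-- **MEANS OF ALL CHAIN-FAMILY PROFILES, depth-graded** (the `j = 0` constant entries of the fits). -/
theorem abs_klAngularMean_msProfileF_le_graded (hann : ∀ m j, 0 ≤ a m j)
    {A : ℝ} (hA : ∀ j ≤ 2, chainSizeSumG d Kp a n N (N - n) j ≤ A) (hA20 : A ≤ 1 / 20)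
    (hd : klCurveD ≤ (bandBounds (show (-4 : ℝ) < -1.1 by norm_num) (show (-1.1 : ℝ) ≤ -0.1 by norm_num)
      (show (-0.1 : ℝ) < 0 by norm_num)).Dtmin - 2 * A)
    {μ : ℝ} (hlo : (-1.1 : ℝ) ≤ μ - A) (hhi : μ + A ≤ -0.1)
    {A₃ A₄ : ℕ → ℝ} (hA₃ : ∀ k ≤ N - n, chainSizeSumG d Kp a n N k 3 ≤ A₃ k) (hA₄ : ∀ k ≤ N - n, chainSizeSumG d Kp a n N k 4 ≤ A₄ k)
    (S : ℕ → TrigPolyC4v) {σ : ℕ → ℕ → ℝ} (hσnn : ∀ k l, 0 ≤ σ k l) (hσ0 : ∀ k ≤ N - n, ∀ q : Momentum, |evalM (S k) q| ≤ σ k 0)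
    (hσ : ∀ k ≤ N - n, ∀ l, 1 ≤ l → l ≤ 5 → ∀ q : Momentum, ‖iteratedFDeriv ℝ l (evalM (S k)) q‖ ≤ σ k l)
    {ε : ℕ → ℕ → ℝ} (hε0 : ∀ m ∈ Ioc n N, ∀ q : Momentum, |evalM (fsub (S (m - n)) (S (m - n - 1))) q| ≤ ε m 0)
    {e : ℕ → ℕ → ℝ} (he : ∀ m ∈ Ioc n N, ∀ j ≤ 4, ∀ q : Momentum, ‖iteratedFDeriv ℝ j (evalM (highPart d (Kp m))) q‖ ≤ e m j)
    (m : ℕ) :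
    |klAngularMean (msProfileF μ S d Kp n N m)| ≤
      msMeanFG σ ε A A₃ A₄ ((bandBounds (show (-4 : ℝ) < -1.1 by norm_num) (show (-1.1 : ℝ) ≤ -0.1 by norm_num)
        (show (-0.1 : ℝ) < 0 by norm_num)).Dtmin) e n N m := by
  by_cases hm : m = n
  · subst hm
    rw [msMeanFG, if_pos rfl, msProfileF_base]
    refine abs_klAngularMean_le' fun θ => ?_
    rw [curveProfile_apply]
    exact hσ0 0 (by omega) _
  by_cases hmem : m ∈ Ioc n N
  · set k := m - n with hkdef
    have hk1 : 1 ≤ k := by have := (Finset.mem_Ioc.mp hmem).1; omega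
    have hk : k ≤ N - n := by have := (Finset.mem_Ioc.mp hmem).2; omega
    have hmk : m = n + k := by have := (Finset.mem_Ioc.mp hmem).1; omega
    rw [msMeanFG, if_neg hm, if_pos hmem]
    have he' : ∀ j ≤ 4, ∀ q : Momentum, ‖iteratedFDeriv ℝ j (evalM (highPart d (Kp (n + k)))) q‖ ≤ e m j := by
      rw [← hmk]; exact he m hmem
    have hstep := chain_step_curve_diff_graded d hnN ha hann le_rfl hA hA20 hd hlo hhi hk1 hk (hA₃ k hk) (hA₄ k hk) he'
    have hM₁ : ∀ z : Momentum, ‖fderiv ℝ (evalM (S (k - 1))) z‖ ≤ σ (k - 1) 1 := fun z => by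
      rw [norm_fderiv_eq_norm_iteratedFDeriv_one]; exact hσ (k - 1) (by omega) 1 le_rfl (by norm_num) z
    refine abs_klAngularMean_le' fun θ => ?_
    rw [msProfileF_slot μ S d Kp hmem θ]
    refine (abs_add_le _ _).trans (add_le_add ?_ ?_)
    · rw [curveProfile_apply]; exact hε0 m hmem _
    · rw [curveProfile_apply, curveProfile_apply]
      have h := (convex_univ).norm_image_sub_le_of_norm_fderiv_le (𝕜 := ℝ) (f := evalM (S (k - 1)))
        (fun z _ => ((contDiff_evalM (S (k - 1)) (k := 1)).differentiable one_ne_zero) z) (fun z _ => hM₁ z)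
        (Set.mem_univ (WithLp.toLp 2 (klFermiPoint μ (msChain d Kp n N (k - 1)) θ) : Momentum))
        (Set.mem_univ (WithLp.toLp 2 (klFermiPoint μ (msChain d Kp n N k) θ) : Momentum))
      rw [Real.norm_eq_abs] at h
      exact h.trans (mul_le_mul_of_nonneg_left (hstep θ).1 (hσnn (k - 1) 1))
  · rw [msProfileF_of_not_mem hm hmem, msMeanFG, if_neg hm, if_neg hmem, klAngularMean_zero, abs_zero]

end Table

/-! ## §3 The budget-parametric slot text from the graded table -/

section MS

variable {L M : ℕ} [NeZero L] [NeZero M] {β U μ : ℝ}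

/-- **(E3a-MS), parametric, AT SCALE `n+1` FROM THE DEPTH-GRADED TERM TABLE** (sizes `msSizeBaseO X σ (A₃ 0) (A₄ 0)` and
`msSizeSlotO X σ ε A (A₃ (m−n₀)) (A₄ (m−n₀)) Dt e n₀ m`, no fit).  Binders as in `twoLegSizesMST_succ_of_chainF_table` (`…MSOfTableF`) minus the fits,
with the chain regime DEPTH-GRADED (`chainSizeSumG`; `A₃ A₄ : ℕ → ℝ`). -/
theorem twoLegSizesMSWith_succ_of_chainF_table_graded (hμ : μ ∈ klWindowC) {K : TrigPolyC4v} {Kp : ℕ → TrigPolyC4v}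
    (hK : ∀ p : Fin 2 → ℝ, K.eval p = ∑ m ∈ range (nScales β + 1), (Kp m).eval p) {n : ℕ} (hn : n + 1 ≤ nScales β) (d : ℕ)
    (hc₁ : Continuous (klLocalPart L M β U μ K (n + 1))) (hc₀ : Continuous (klLocalPart L M β U μ K n))
    {S : ℕ → TrigPolyC4v}
    (hS : ∀ θ, klLocalPart L M β U μ K (n + 1) θ - klLocalPart L M β U μ K n θ =
      (S (nScales β - (n + 1))).eval (klFermiPoint μ K θ))
    {a : ℕ → ℕ → ℝ} (hann : ∀ m j, 0 ≤ a m j)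
    (ha : ∀ m ≤ nScales β, ∀ j ≤ 4, ∀ q : Momentum, ‖iteratedFDeriv ℝ j (evalM (Kp m)) q‖ ≤ a m j)
    {A : ℝ} (hA : ∀ j ≤ 2, chainSizeSumG d Kp a (n + 1) (nScales β) (nScales β - (n + 1)) j ≤ A) (hA20 : A ≤ 1 / 20)
    (hd : klCurveD ≤ (bandBounds (show (-4 : ℝ) < -1.1 by norm_num) (show (-1.1 : ℝ) ≤ -0.1 by norm_num)
      (show (-0.1 : ℝ) < 0 by norm_num)).Dtmin - 2 * A)
    (hlo : (-1.1 : ℝ) ≤ μ - A) (hhi : μ + A ≤ -0.1)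
    {A₃ A₄ : ℕ → ℝ} (hA₃ : ∀ k ≤ nScales β - (n + 1), chainSizeSumG d Kp a (n + 1) (nScales β) k 3 ≤ A₃ k)
    (hA₄ : ∀ k ≤ nScales β - (n + 1), chainSizeSumG d Kp a (n + 1) (nScales β) k 4 ≤ A₄ k)
    {σ : ℕ → ℕ → ℝ} (hσnn : ∀ k l, 0 ≤ σ k l)
    (hσ0 : ∀ k ≤ nScales β - (n + 1), ∀ q : Momentum, |evalM (S k) q| ≤ σ k 0)
    (hσ : ∀ k ≤ nScales β - (n + 1), ∀ l, 1 ≤ l → l ≤ 5 → ∀ q : Momentum, ‖iteratedFDeriv ℝ l (evalM (S k)) q‖ ≤ σ k l)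
    {ε : ℕ → ℕ → ℝ} (hεnn : ∀ m l, 0 ≤ ε m l)
    (hε0 : ∀ m ∈ Ioc (n + 1) (nScales β), ∀ q : Momentum, |evalM (fsub (S (m - (n + 1))) (S (m - (n + 1) - 1))) q| ≤ ε m 0)
    (hε : ∀ m ∈ Ioc (n + 1) (nScales β), ∀ l, 1 ≤ l → l ≤ 4 → ∀ q : Momentum,
      ‖iteratedFDeriv ℝ l (evalM (fsub (S (m - (n + 1))) (S (m - (n + 1) - 1)))) q‖ ≤ ε m l)
    {e : ℕ → ℕ → ℝ}
    (he : ∀ m ∈ Ioc (n + 1) (nScales β), ∀ j ≤ 4, ∀ q : Momentum, ‖iteratedFDeriv ℝ j (evalM (highPart d (Kp m))) q‖ ≤ e m j)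
    {X : ℝ} (hX : ∀ l ≤ 4, ∀ x : ℝ, ‖iteratedFDeriv ℝ l salmhoferCutoff x‖ ≤ X) :
    TwoLegSizesMSWith L M β U μ K.eval (n + 1) (msSizeBaseO X σ (A₃ 0) (A₄ 0))
      (fun m j => msSizeSlotO X σ ε A (A₃ (m - (n + 1))) (A₄ (m - (n + 1))) ((bandBounds (show (-4 : ℝ) < -1.1 by norm_num)
        (show (-1.1 : ℝ) ≤ -0.1 by norm_num) (show (-0.1 : ℝ) < 0 by norm_num)).Dtmin) e (n + 1) m j) := by
  set B := bandBounds (show (-4 : ℝ) < -1.1 by norm_num) (show (-1.1 : ℝ) ≤ -0.1 by norm_num) (show (-0.1 : ℝ) < 0 by norm_num)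
    with hBdef
  have hX0 : 0 ≤ X := cutoffNumeral_nonneg hX
  have hC : ∀ k ≤ nScales β - (n + 1), ContDiff ℝ 4 (klFermiPoint μ (msChain d Kp (n + 1) (nScales β) k)) :=
    fun k hk => (chain_curve_sizes_graded d hn ha hann le_rfl hA hA20 hd hlo hhi hk (hA₃ k hk) (hA₄ k hk) 0).2.1
  have hGs := fun m j (hj : j ≤ 4) i (hi : i ≤ j) t =>
    msProfileF_centred_sizes_graded d hn ha hann hA hA20 hd hlo hhi hA₃ hA₄ S hσnn hσ0 hσ hεnn hε0 hε he m hj hi t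
  have hmean := abs_klAngularMean_msProfileF_le_graded d hn ha hann hA hA20 hd hlo hhi hA₃ hA₄ S hσnn hσ0 hσ hε0 he
  refine (twoLegSizesMSWith_succ_of_chainF_sizes hμ hK hn d hc₁ hc₀ hS hC hX
    (fun m j => msGsFG σ ε A A₃ A₄ B.Dtmin e (n + 1) (nScales β) m j) hGs).mono ?_ ?_
  · intro j _
    have h1 : |klAngularMean (msProfileF μ S d Kp (n + 1) (nScales β) (n + 1))| ≤ σ 0 0 := by
      simpa [msMeanFG] using hmean (n + 1)
    have h2 : msGsFG σ ε A A₃ A₄ B.Dtmin e (n + 1) (nScales β) (n + 1) j = bellCumOsc (σ 0) (msD (A₃ 0) (A₄ 0)) j := by simp [msGsFG]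
    exact extSize_mono hX0 h1 h2.le j
  · intro m hm j _
    have hne : m ≠ n + 1 := by have := (Finset.mem_Ioc.mp hm).1; omega
    have h1 : |klAngularMean (msProfileF μ S d Kp (n + 1) (nScales β) m)| ≤
        ε m 0 + σ (m - (n + 1) - 1) 1 * msdD A (A₃ (m - (n + 1))) (A₄ (m - (n + 1))) B.Dtmin (e m) 0 := by
      simpa [msMeanFG, hne, hm] using hmean m
    have h2 : msGsFG σ ε A A₃ A₄ B.Dtmin e (n + 1) (nScales β) m j =
        bellCumOsc (ε m) (msD (A₃ (m - (n + 1))) (A₄ (m - (n + 1)))) j +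
          bellDiffCum (σ (m - (n + 1) - 1)) (msD (A₃ (m - (n + 1))) (A₄ (m - (n + 1))))
            (msdD A (A₃ (m - (n + 1))) (A₄ (m - (n + 1))) B.Dtmin (e m)) j := by
      simp [msGsFG, hne, hm]
    exact extSize_mono hX0 h1 h2.le j

/-- **(E3a-MS), parametric, AT SCALE `0` FROM THE DEPTH-GRADED TERM TABLE** (sizes `msSizeBaseO X σ (A₃ 0) (A₄ 0)` and
`msSizeSlotO X σ ε A (A₃ m) (A₄ m) Dt e 0 m`, no fit). -/
theorem twoLegSizesMSWith_zero_of_chainF_table_graded (hμ : μ ∈ klWindowC) {K : TrigPolyC4v} {Kp : ℕ → TrigPolyC4v}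
    (hK : ∀ p : Fin 2 → ℝ, K.eval p = ∑ m ∈ range (nScales β + 1), (Kp m).eval p) (d : ℕ)
    (hc₀ : Continuous (klLocalPart L M β U μ K 0))
    {S : ℕ → TrigPolyC4v}
    (hS : ∀ θ, klLocalPart L M β U μ K 0 θ - K.eval (klFermiPoint μ K θ) = (S (nScales β)).eval (klFermiPoint μ K θ))
    {a : ℕ → ℕ → ℝ} (hann : ∀ m j, 0 ≤ a m j)
    (ha : ∀ m ≤ nScales β, ∀ j ≤ 4, ∀ q : Momentum, ‖iteratedFDeriv ℝ j (evalM (Kp m)) q‖ ≤ a m j)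
    {A : ℝ} (hA : ∀ j ≤ 2, chainSizeSumG d Kp a 0 (nScales β) (nScales β - 0) j ≤ A) (hA20 : A ≤ 1 / 20)
    (hd : klCurveD ≤ (bandBounds (show (-4 : ℝ) < -1.1 by norm_num) (show (-1.1 : ℝ) ≤ -0.1 by norm_num)
      (show (-0.1 : ℝ) < 0 by norm_num)).Dtmin - 2 * A)
    (hlo : (-1.1 : ℝ) ≤ μ - A) (hhi : μ + A ≤ -0.1)
    {A₃ A₄ : ℕ → ℝ} (hA₃ : ∀ k ≤ nScales β - 0, chainSizeSumG d Kp a 0 (nScales β) k 3 ≤ A₃ k)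
    (hA₄ : ∀ k ≤ nScales β - 0, chainSizeSumG d Kp a 0 (nScales β) k 4 ≤ A₄ k)
    {σ : ℕ → ℕ → ℝ} (hσnn : ∀ k l, 0 ≤ σ k l)
    (hσ0 : ∀ k ≤ nScales β, ∀ q : Momentum, |evalM (S k) q| ≤ σ k 0)
    (hσ : ∀ k ≤ nScales β, ∀ l, 1 ≤ l → l ≤ 5 → ∀ q : Momentum, ‖iteratedFDeriv ℝ l (evalM (S k)) q‖ ≤ σ k l)
    {ε : ℕ → ℕ → ℝ} (hεnn : ∀ m l, 0 ≤ ε m l)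
    (hε0 : ∀ m ∈ Ioc 0 (nScales β), ∀ q : Momentum, |evalM (fsub (S m) (S (m - 1))) q| ≤ ε m 0)
    (hε : ∀ m ∈ Ioc 0 (nScales β), ∀ l, 1 ≤ l → l ≤ 4 → ∀ q : Momentum,
      ‖iteratedFDeriv ℝ l (evalM (fsub (S m) (S (m - 1)))) q‖ ≤ ε m l)
    {e : ℕ → ℕ → ℝ}
    (he : ∀ m ∈ Ioc 0 (nScales β), ∀ j ≤ 4, ∀ q : Momentum, ‖iteratedFDeriv ℝ j (evalM (highPart d (Kp m))) q‖ ≤ e m j)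
    {X : ℝ} (hX : ∀ l ≤ 4, ∀ x : ℝ, ‖iteratedFDeriv ℝ l salmhoferCutoff x‖ ≤ X) :
    TwoLegSizesMSWith L M β U μ K.eval 0 (msSizeBaseO X σ (A₃ 0) (A₄ 0))
      (fun m j => msSizeSlotO X σ ε A (A₃ (m - 0)) (A₄ (m - 0)) ((bandBounds (show (-4 : ℝ) < -1.1 by norm_num)
        (show (-1.1 : ℝ) ≤ -0.1 by norm_num) (show (-0.1 : ℝ) < 0 by norm_num)).Dtmin) e 0 m j) := by
  set B := bandBounds (show (-4 : ℝ) < -1.1 by norm_num) (show (-1.1 : ℝ) ≤ -0.1 by norm_num) (show (-0.1 : ℝ) < 0 by norm_num)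
    with hBdef
  have hX0 : 0 ≤ X := cutoffNumeral_nonneg hX
  have hn : 0 ≤ nScales β := Nat.zero_le _
  have hC : ∀ k ≤ nScales β, ContDiff ℝ 4 (klFermiPoint μ (msChain d Kp 0 (nScales β) k)) :=
    fun k hk => (chain_curve_sizes_graded d hn ha hann le_rfl hA hA20 hd hlo hhi (k := k) (by omega)
      (hA₃ k (by omega)) (hA₄ k (by omega)) 0).2.1
  have hσ0' : ∀ k ≤ nScales β - 0, ∀ q : Momentum, |evalM (S k) q| ≤ σ k 0 := fun k hk => hσ0 k (by omega)
  have hσ' : ∀ k ≤ nScales β - 0, ∀ l, 1 ≤ l → l ≤ 5 → ∀ q : Momentum, ‖iteratedFDeriv ℝ l (evalM (S k)) q‖ ≤ σ k l :=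
    fun k hk => hσ k (by omega)
  have hε0' : ∀ m ∈ Ioc 0 (nScales β), ∀ q : Momentum, |evalM (fsub (S (m - 0)) (S (m - 0 - 1))) q| ≤ ε m 0 := by
    simpa only [Nat.sub_zero] using hε0
  have hε' : ∀ m ∈ Ioc 0 (nScales β), ∀ l, 1 ≤ l → l ≤ 4 → ∀ q : Momentum,
      ‖iteratedFDeriv ℝ l (evalM (fsub (S (m - 0)) (S (m - 0 - 1)))) q‖ ≤ ε m l := by
    simpa only [Nat.sub_zero] using hε
  have hGs := fun m j (hj : j ≤ 4) i (hi : i ≤ j) t =>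
    msProfileF_centred_sizes_graded d hn ha hann hA hA20 hd hlo hhi hA₃ hA₄ S hσnn hσ0' hσ' hεnn hε0' hε' he m hj hi t
  have hmean := abs_klAngularMean_msProfileF_le_graded d hn ha hann hA hA20 hd hlo hhi hA₃ hA₄ S hσnn hσ0' hσ' hε0' he
  refine (twoLegSizesMSWith_zero_of_chainF_sizes hμ hK d hc₀ hS hC hX
    (fun m j => msGsFG σ ε A A₃ A₄ B.Dtmin e 0 (nScales β) m j) hGs).mono ?_ ?_
  · intro j _
    have h1 : |klAngularMean (msProfileF μ S d Kp 0 (nScales β) 0)| ≤ σ 0 0 := by simpa [msMeanFG] using hmean 0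
    have h2 : msGsFG σ ε A A₃ A₄ B.Dtmin e 0 (nScales β) 0 j = bellCumOsc (σ 0) (msD (A₃ 0) (A₄ 0)) j := by simp [msGsFG]
    exact extSize_mono hX0 h1 h2.le j
  · intro m hm j _
    have hne : m ≠ 0 := by have := (Finset.mem_Ioc.mp hm).1; omega
    have h1 : |klAngularMean (msProfileF μ S d Kp 0 (nScales β) m)| ≤
        ε m 0 + σ (m - 0 - 1) 1 * msdD A (A₃ (m - 0)) (A₄ (m - 0)) B.Dtmin (e m) 0 := by
      simpa [msMeanFG, hne, hm] using hmean m
    have h2 : msGsFG σ ε A A₃ A₄ B.Dtmin e 0 (nScales β) m j =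
        bellCumOsc (ε m) (msD (A₃ (m - 0)) (A₄ (m - 0))) j +
          bellDiffCum (σ (m - 0 - 1)) (msD (A₃ (m - 0)) (A₄ (m - 0))) (msdD A (A₃ (m - 0)) (A₄ (m - 0)) B.Dtmin (e m)) j := by
      simp [msGsFG, hne, hm]
    exact extSize_mono hX0 h1 h2.le j


end MS

end Summit.HubbardSuperconductivity.HubbardSuperconductivity.Theorems.KLRegimeSplit

end
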